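import Summits.QuantumFields.GaugeBoot.OneOverNLeibniz
import HarnessLib

/-!
# First-order factorization, I: the equation of the defect (gauge-boot, ADDENDUM 30 part Q)

HONEST FRAMING (cell `pub-gaugeboot`, page 1 of every file): the venture produces certified bounds
on lattice expectations at stated coupling, gauge group, dimension and torus size; NOT a mass gap,
NOT a continuum limit, NOT a string tension; NOT Yang–Mills-summit-bearing (barriers
`FixedCouplingUltralocality`, `PerturbativeInvisibility`).  Strong-coupling `SO(N)` lattice gauge theory (S. Chatterjee, Comm. Math.
Phys. **366** (2019); S. Chatterjee, J. Jafarov, arXiv:1604.04777); nothing about four-dimensional continuum Yang–Mills or a mass gap.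

## Content

Towards the lane's FIRST-ORDER FACTORIZATION `f_1(l₁,…,lₙ) = Σᵢ f_1(lᵢ) Π_{j≠i} f_0(lⱼ)` (sibling `OneOverNFirstOrderFactorization`).
Abstractly: let `f₀` be multiplicative on genuine loop sequences (`f₀(s) = Π f₀((lᵢ))`, Chatterjee's Corollary 3.2) and solve the
limiting master loop equation, let `f₁` solve the first-order equation `|s|f₁ − RHS(f₁) = |s|f₀ + Σ_{𝕋∓}±f₀`, and let `Q` be the
derivation `Q(l₁,…,lₙ) = Σᵢ f₁((lᵢ)) Π_{j≠i} f₀((lⱼ))` of the product `P = Π f₀((lᵢ))`.  ★ `firstOrder_defect_equation`: the defect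
`G = f₁ − Q` satisfies, at every genuine non-null `s`,

  `|s| G(s) − (Σ_{𝕊⁻}G − Σ_{𝕊⁺}G + βΣ_{𝔻⁻}G − βΣ_{𝔻⁺}G) = − Σᵢ P(l₁..lᵢ₋₁)P(lᵢ₊₁..lₙ) · (Σ_{𝕊⁻(lᵢ)} G((pieces)) − Σ_{𝕊⁺(lᵢ)} G((pieces)))`,

a homogeneous linear equation involving `G` only on splitting/deformation results and on the TWO-loop sequences made of the
splitting pieces of single components (the single-loop master loop equations of `f₀, f₁` at `(lᵢ)` cancel everything else).

Everything is `[folklore]`.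
-/

noncomputable section

open Finset
open Literature.MathematicalPhysics.QuantumLattice (ZdPlaquette)
open Literature.MathematicalPhysics.QuantumFieldTheory.Chatterjee2019LargeN
open Literature.MathematicalPhysics.QuantumFieldTheory.Chatterjee2019LargeN.Word
  (posSplit₁ posSplit₂ negSplit₁ negSplit₂ negTwist posTwist posDeform negDeform)

namespace Summit.QuantumFields.GaugeBoot

namespace StringDuality

variable {d : ℕ}

/-- `s = (l₁,…,lᵢ₋₁) ++ (lᵢ) ++ (lᵢ₊₁,…,lₙ)`. [folklore] -/
theorem take_append_get_append_drop (s : LoopSeq d) (i : Fin s.length) :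
    s.take i ++ [s.get i] ++ s.drop (i + 1) = s := by
  rw [List.append_assoc, List.singleton_append, List.get_eq_getElem, List.cons_getElem_drop_succ, List.take_append_drop]

/-- A sub-list of a genuine loop sequence is genuine: the middle block of a genuine `u ++ m ++ v`. [folklore] -/
theorem isLoopSeq_middle {u m v : LoopSeq d} (h : IsLoopSeq (u ++ m ++ v)) : IsLoopSeq m :=
  fun l hl => h l (by simp [hl])

/-- Splitting sums of a genuine loop: no pruning (positive). [cite: Chatterjee2019LargeN, Lemma 9.3] -/
theorem sum_prune_posSplit {l : List (DEdge d)} (hl : IsLoop l) (g : LoopSeq d → ℝ) :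
    ∑ q : {xy : Fin l.length × Fin l.length // xy.1 ≠ xy.2 ∧ l.get xy.2 = l.get xy.1},
        g (LoopSeq.prune [posSplit₁ l q.1.1 q.1.2, posSplit₂ l q.1.1 q.1.2]) =
      ∑ q : {xy : Fin l.length × Fin l.length // xy.1 ≠ xy.2 ∧ l.get xy.2 = l.get xy.1},
        g [posSplit₁ l q.1.1 q.1.2, posSplit₂ l q.1.1 q.1.2] :=
  Finset.sum_congr rfl fun q _ => by rw [prune_posSplit hl q.2.1 q.2.2]

/-- Splitting sums of a genuine loop: no pruning (negative). [cite: Chatterjee2019LargeN, Lemma 9.5] -/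
theorem sum_prune_negSplit {l : List (DEdge d)} (hl : IsLoop l) (g : LoopSeq d → ℝ) :
    ∑ q : {xy : Fin l.length × Fin l.length // l.get xy.2 = DEdge.inv (l.get xy.1)},
        g (LoopSeq.prune [negSplit₁ l q.1.1 q.1.2, negSplit₂ l q.1.1 q.1.2]) =
      ∑ q : {xy : Fin l.length × Fin l.length // l.get xy.2 = DEdge.inv (l.get xy.1)},
        g [negSplit₁ l q.1.1 q.1.2, negSplit₂ l q.1.1 q.1.2] :=
  Finset.sum_congr rfl fun q _ => by rw [prune_negSplit hl q.2]

/-- ★ **The equation of the first-order defect.**  See the module docstring.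
[cite: Chatterjee2019LargeN, Corollary 3.2, Theorem 9.9; ChatterjeeJafarov2016OneOverN, Theorem 5.1 (recursion at k = 1)] -/
theorem firstOrder_defect_equation {β : ℝ} {f0 f1 P Q G : LoopSeq d → ℝ}
    (h0nil : f0 [] = 1) (h1nil : f1 [] = 0)
    (hP0 : P [] = 1) (hPc : ∀ (l : List (DEdge d)) (u : LoopSeq d), P (l :: u) = f0 [l] * P u)
    (hQ0 : Q [] = 0) (hQc : ∀ (l : List (DEdge d)) (u : LoopSeq d), Q (l :: u) = f1 [l] * P u + f0 [l] * Q u)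
    (hG : ∀ u : LoopSeq d, G u = f1 u - Q u)
    (hmul : ∀ u : LoopSeq d, IsLoopSeq u → f0 u = P u)
    (hE0 : ∀ u : LoopSeq d, IsLoopSeq u → u ≠ [] →
      (u.len : ℝ) * f0 u -
          ((∑ o : InvIdx u, f0 (u.negSplitAt o)) - (∑ o : SameIdx u, f0 (u.posSplitAt o))
            + β * (∑ o : DeformIdx u, f0 (u.negDeformAt o)) - β * (∑ o : DeformIdx u, f0 (u.posDeformAt o))) = 0)
    (hE1 : ∀ u : LoopSeq d, IsLoopSeq u → u ≠ [] →
      (u.len : ℝ) * f1 u -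
          ((∑ o : InvIdx u, f1 (u.negSplitAt o)) - (∑ o : SameIdx u, f1 (u.posSplitAt o))
            + β * (∑ o : DeformIdx u, f1 (u.negDeformAt o)) - β * (∑ o : DeformIdx u, f1 (u.posDeformAt o))) =
        (u.len : ℝ) * f0 u + ((∑ o : SameIdx u, f0 (u.negTwistAt o)) - ∑ o : InvIdx u, f0 (u.posTwistAt o)))
    {s : LoopSeq d} (hs : IsLoopSeq s) (hne : s ≠ []) :
    (s.len : ℝ) * G s -
        ((∑ o : InvIdx s, G (s.negSplitAt o)) - (∑ o : SameIdx s, G (s.posSplitAt o))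
          + β * (∑ o : DeformIdx s, G (s.negDeformAt o)) - β * (∑ o : DeformIdx s, G (s.posDeformAt o))) =
      -∑ i : Fin s.length, P (s.take i) * P (s.drop (i + 1)) *
        ((∑ q : {xy : Fin (s.get i).length × Fin (s.get i).length // (s.get i).get xy.2 = DEdge.inv ((s.get i).get xy.1)},
            G [negSplit₁ (s.get i) q.1.1 q.1.2, negSplit₂ (s.get i) q.1.1 q.1.2])
          - ∑ q : {xy : Fin (s.get i).length × Fin (s.get i).length // xy.1 ≠ xy.2 ∧ (s.get i).get xy.2 = (s.get i).get xy.1},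
            G [posSplit₁ (s.get i) q.1.1 q.1.2, posSplit₂ (s.get i) q.1.1 q.1.2]) := by
  have hsne : ∀ l ∈ s, l ≠ [] := fun l hl => (hs l hl).2
  have hloop : ∀ i : Fin s.length, IsLoop (s.get i) := fun i => (hs _ (List.get_mem s i)).1
  have hget : ∀ i : Fin s.length, IsLoopSeq ([s.get i] : LoopSeq d) := fun i l hl => by
    rw [List.mem_singleton] at hl; subst hl; exact hs _ (List.get_mem s i)
  have hgetne : ∀ i : Fin s.length, ([s.get i] : LoopSeq d) ≠ [] := fun i => List.cons_ne_nil _ _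
  -- values of `P`, `Q` on small and pruned lists
  have hPmid : ∀ w : List (DEdge d), P (LoopSeq.prune [w]) = f0 (LoopSeq.prune [w]) :=
    mulFun_prune_singleton hP0 hPc h0nil (fun w _ => rfl)
  have hQmid : ∀ w : List (DEdge d), Q (LoopSeq.prune [w]) = f1 (LoopSeq.prune [w]) :=
    derFun_prune_singleton hP0 hQ0 hQc h1nil (fun w _ => rfl)
  have hQpair : ∀ x y : List (DEdge d), IsLoopSeq ([x, y] : LoopSeq d) → Q [x, y] = f1 [x, y] - G [x, y] := by
    intro x y _; rw [hG]; ring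
  have hPpair : ∀ x y : List (DEdge d), IsLoopSeq ([x, y] : LoopSeq d) → P [x, y] = f0 [x, y] := fun x y h => (hmul _ h).symm
  -- genuineness of the results, written as concatenations
  have gS : ∀ (i : Fin s.length) (q : {xy : Fin (s.get i).length × Fin (s.get i).length //
      xy.1 ≠ xy.2 ∧ (s.get i).get xy.2 = (s.get i).get xy.1}),
      IsLoopSeq ([posSplit₁ (s.get i) q.1.1 q.1.2, posSplit₂ (s.get i) q.1.1 q.1.2] : LoopSeq d) := by
    intro i q
    have h := hs.posSplitAt ⟨i, q⟩
    have e : s.posSplitAt ⟨i, q⟩ = s.take i ++ LoopSeq.prune [posSplit₁ (s.get i) q.1.1 q.1.2, posSplit₂ (s.get i) q.1.1 q.1.2]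
        ++ s.drop (i + 1) := (replaceAt_eq_append hsne i _)
    rw [e, prune_posSplit (hloop i) q.2.1 q.2.2] at h
    exact isLoopSeq_middle h
  have gI : ∀ (i : Fin s.length) (q : {xy : Fin (s.get i).length × Fin (s.get i).length //
      (s.get i).get xy.2 = DEdge.inv ((s.get i).get xy.1)}),
      IsLoopSeq ([negSplit₁ (s.get i) q.1.1 q.1.2, negSplit₂ (s.get i) q.1.1 q.1.2] : LoopSeq d) := by
    intro i q
    have h := hs.negSplitAt ⟨i, q⟩
    have e : s.negSplitAt ⟨i, q⟩ = s.take i ++ LoopSeq.prune [negSplit₁ (s.get i) q.1.1 q.1.2, negSplit₂ (s.get i) q.1.1 q.1.2]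
        ++ s.drop (i + 1) := (replaceAt_eq_append hsne i _)
    rw [e, prune_negSplit (hloop i) q.2] at h
    exact isLoopSeq_middle h
  have gTN : ∀ (i : Fin s.length) (q : {xy : Fin (s.get i).length × Fin (s.get i).length //
      xy.1 ≠ xy.2 ∧ (s.get i).get xy.2 = (s.get i).get xy.1}),
      IsLoopSeq (s.take i ++ LoopSeq.prune [negTwist (s.get i) q.1.1 q.1.2] ++ s.drop (i + 1)) := by
    intro i q; rw [← replaceAt_eq_append hsne]; exact hs.negTwistAt ⟨i, q⟩
  have gTP : ∀ (i : Fin s.length) (q : {xy : Fin (s.get i).length × Fin (s.get i).length //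
      (s.get i).get xy.2 = DEdge.inv ((s.get i).get xy.1)}),
      IsLoopSeq (s.take i ++ LoopSeq.prune [posTwist (s.get i) q.1.1 q.1.2] ++ s.drop (i + 1)) := by
    intro i q; rw [← replaceAt_eq_append hsne]; exact hs.posTwistAt ⟨i, q⟩
  -- per-component abbreviations (all inner sums are over the locations of `lᵢ = s.get i`)
  set PP : Fin s.length → ℝ := fun i => P (s.take i) * P (s.drop (i + 1)) with hPP
  set A : Fin s.length → ℝ := fun i => Q (s.take i) * P (s.drop (i + 1)) + P (s.take i) * Q (s.drop (i + 1)) with hA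
  set SSf0 : Fin s.length → ℝ := fun i => ∑ q : {xy : Fin (s.get i).length × Fin (s.get i).length //
      xy.1 ≠ xy.2 ∧ (s.get i).get xy.2 = (s.get i).get xy.1}, f0 [posSplit₁ (s.get i) q.1.1 q.1.2, posSplit₂ (s.get i) q.1.1 q.1.2]
    with hSSf0
  set SSf1 : Fin s.length → ℝ := fun i => ∑ q : {xy : Fin (s.get i).length × Fin (s.get i).length //
      xy.1 ≠ xy.2 ∧ (s.get i).get xy.2 = (s.get i).get xy.1}, f1 [posSplit₁ (s.get i) q.1.1 q.1.2, posSplit₂ (s.get i) q.1.1 q.1.2]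
    with hSSf1
  set SSG : Fin s.length → ℝ := fun i => ∑ q : {xy : Fin (s.get i).length × Fin (s.get i).length //
      xy.1 ≠ xy.2 ∧ (s.get i).get xy.2 = (s.get i).get xy.1}, G [posSplit₁ (s.get i) q.1.1 q.1.2, posSplit₂ (s.get i) q.1.1 q.1.2]
    with hSSG
  set SIf0 : Fin s.length → ℝ := fun i => ∑ q : {xy : Fin (s.get i).length × Fin (s.get i).length //
      (s.get i).get xy.2 = DEdge.inv ((s.get i).get xy.1)}, f0 [negSplit₁ (s.get i) q.1.1 q.1.2, negSplit₂ (s.get i) q.1.1 q.1.2]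
    with hSIf0
  set SIf1 : Fin s.length → ℝ := fun i => ∑ q : {xy : Fin (s.get i).length × Fin (s.get i).length //
      (s.get i).get xy.2 = DEdge.inv ((s.get i).get xy.1)}, f1 [negSplit₁ (s.get i) q.1.1 q.1.2, negSplit₂ (s.get i) q.1.1 q.1.2]
    with hSIf1
  set SIG : Fin s.length → ℝ := fun i => ∑ q : {xy : Fin (s.get i).length × Fin (s.get i).length //
      (s.get i).get xy.2 = DEdge.inv ((s.get i).get xy.1)}, G [negSplit₁ (s.get i) q.1.1 q.1.2, negSplit₂ (s.get i) q.1.1 q.1.2]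
    with hSIG
  set DPf0 : Fin s.length → ℝ := fun i => ∑ y : (Σ x : Fin (s.get i).length, ↥(plaquettesAt ((s.get i).get x))),
      f0 (LoopSeq.prune [posDeform (s.get i) y.1 y.2.1]) with hDPf0
  set DPf1 : Fin s.length → ℝ := fun i => ∑ y : (Σ x : Fin (s.get i).length, ↥(plaquettesAt ((s.get i).get x))),
      f1 (LoopSeq.prune [posDeform (s.get i) y.1 y.2.1]) with hDPf1
  set DNf0 : Fin s.length → ℝ := fun i => ∑ y : (Σ x : Fin (s.get i).length, ↥(plaquettesAt ((s.get i).get x))),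
      f0 (LoopSeq.prune [negDeform (s.get i) y.1 y.2.1]) with hDNf0
  set DNf1 : Fin s.length → ℝ := fun i => ∑ y : (Σ x : Fin (s.get i).length, ↥(plaquettesAt ((s.get i).get x))),
      f1 (LoopSeq.prune [negDeform (s.get i) y.1 y.2.1]) with hDNf1
  set TN : Fin s.length → ℝ := fun i => ∑ q : {xy : Fin (s.get i).length × Fin (s.get i).length //
      xy.1 ≠ xy.2 ∧ (s.get i).get xy.2 = (s.get i).get xy.1}, f0 (LoopSeq.prune [negTwist (s.get i) q.1.1 q.1.2]) with hTN
  set TP : Fin s.length → ℝ := fun i => ∑ q : {xy : Fin (s.get i).length × Fin (s.get i).length //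
      (s.get i).get xy.2 = DEdge.inv ((s.get i).get xy.1)}, f0 (LoopSeq.prune [posTwist (s.get i) q.1.1 q.1.2]) with hTP
  -- (1) the four operation sums of `Q` over `s`, by component
  have cS : ∑ o : SameIdx s, Q (s.posSplitAt o) = ∑ i : Fin s.length, (A i * SSf0 i + PP i * (SSf1 i - SSG i)) := by
    rw [sum_posSplitAt_eq hsne]
    refine Finset.sum_congr rfl fun i _ => ?_
    simp only [hA, hPP, hSSf0, hSSf1, hSSG, Finset.mul_sum, ← Finset.sum_sub_distrib, ← Finset.sum_add_distrib]
    refine Finset.sum_congr rfl fun q _ => ?_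
    rw [prune_posSplit (hloop i) q.2.1 q.2.2, derFun_append3 hP0 hPc hQ0 hQc, hQpair _ _ (gS i q), hPpair _ _ (gS i q)]
    ring
  have cI : ∑ o : InvIdx s, Q (s.negSplitAt o) = ∑ i : Fin s.length, (A i * SIf0 i + PP i * (SIf1 i - SIG i)) := by
    rw [sum_negSplitAt_eq hsne]
    refine Finset.sum_congr rfl fun i _ => ?_
    simp only [hA, hPP, hSIf0, hSIf1, hSIG, Finset.mul_sum, ← Finset.sum_sub_distrib, ← Finset.sum_add_distrib]
    refine Finset.sum_congr rfl fun q _ => ?_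
    rw [prune_negSplit (hloop i) q.2, derFun_append3 hP0 hPc hQ0 hQc, hQpair _ _ (gI i q), hPpair _ _ (gI i q)]
    ring
  have cDP : ∑ o : DeformIdx s, Q (s.posDeformAt o) = ∑ i : Fin s.length, (A i * DPf0 i + PP i * DPf1 i) := by
    rw [sum_posDeformAt_eq hsne]
    refine Finset.sum_congr rfl fun i _ => ?_
    simp only [hA, hPP, hDPf0, hDPf1, Finset.mul_sum, ← Finset.sum_add_distrib]
    refine Finset.sum_congr rfl fun y _ => ?_
    rw [derFun_append3 hP0 hPc hQ0 hQc, hQmid, hPmid]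
    ring
  have cDN : ∑ o : DeformIdx s, Q (s.negDeformAt o) = ∑ i : Fin s.length, (A i * DNf0 i + PP i * DNf1 i) := by
    rw [sum_negDeformAt_eq hsne]
    refine Finset.sum_congr rfl fun i _ => ?_
    simp only [hA, hPP, hDNf0, hDNf1, Finset.mul_sum, ← Finset.sum_add_distrib]
    refine Finset.sum_congr rfl fun y _ => ?_
    rw [derFun_append3 hP0 hPc hQ0 hQc, hQmid, hPmid]
    ring
  -- (2) the twisting sums of `f0` over `s`, by component
  have cTN : ∑ o : SameIdx s, f0 (s.negTwistAt o) = ∑ i : Fin s.length, PP i * TN i := by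
    rw [sum_negTwistAt_eq hsne]
    refine Finset.sum_congr rfl fun i _ => ?_
    simp only [hPP, hTN, Finset.mul_sum]
    refine Finset.sum_congr rfl fun q _ => ?_
    rw [hmul _ (gTN i q), mulFun_append3 hP0 hPc, hPmid]
    ring
  have cTP : ∑ o : InvIdx s, f0 (s.posTwistAt o) = ∑ i : Fin s.length, PP i * TP i := by
    rw [sum_posTwistAt_eq hsne]
    refine Finset.sum_congr rfl fun i _ => ?_
    simp only [hPP, hTP, Finset.mul_sum]
    refine Finset.sum_congr rfl fun q _ => ?_
    rw [hmul _ (gTP i q), mulFun_append3 hP0 hPc, hPmid]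
    ring
  -- (3) `Q(s)` and `f0(s)` seen from component `i`; `|s| = Σ |lᵢ|`
  have eQs : ∀ i : Fin s.length, Q s = A i * f0 [s.get i] + PP i * f1 [s.get i] := by
    intro i
    conv_lhs => rw [← take_append_get_append_drop s i]
    rw [derFun_append3 hP0 hPc hQ0 hQc, mulFun_singleton hP0 hPc, derFun_singleton hP0 hQ0 hQc]
    simp only [hA, hPP]
    ring
  have ef0s : ∀ i : Fin s.length, f0 s = PP i * f0 [s.get i] := by
    intro i
    rw [hmul s hs]
    conv_lhs => rw [← take_append_get_append_drop s i]
    rw [mulFun_append3 hP0 hPc, mulFun_singleton hP0 hPc]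
    simp only [hPP]
    ring
  have eLen : (s.len : ℝ) = ∑ i : Fin s.length, ((s.get i).length : ℝ) := len_eq_sum_get s
  -- (4) the single-loop equations at `(lᵢ)`, in location-sum form
  have E0 : ∀ i : Fin s.length,
      ((s.get i).length : ℝ) * f0 [s.get i] - (SIf0 i - SSf0 i + β * DNf0 i - β * DPf0 i) = 0 := by
    intro i
    have h := hE0 [s.get i] (hget i) (hgetne i)
    rw [len_singleton, sum_negSplitAt_singleton, sum_posSplitAt_singleton, sum_negDeformAt_singleton,
      sum_posDeformAt_singleton, sum_prune_posSplit (hloop i), sum_prune_negSplit (hloop i)] at h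
    simp only [hSIf0, hSSf0, hDNf0, hDPf0]
    exact h
  have E1 : ∀ i : Fin s.length,
      ((s.get i).length : ℝ) * f1 [s.get i] - (SIf1 i - SSf1 i + β * DNf1 i - β * DPf1 i) =
        ((s.get i).length : ℝ) * f0 [s.get i] + (TN i - TP i) := by
    intro i
    have h := hE1 [s.get i] (hget i) (hgetne i)
    rw [len_singleton, sum_negSplitAt_singleton, sum_posSplitAt_singleton, sum_negDeformAt_singleton,
      sum_posDeformAt_singleton, sum_negTwistAt_singleton, sum_posTwistAt_singleton, sum_prune_posSplit (hloop i),
      sum_prune_negSplit (hloop i)] at h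
    simp only [hSIf1, hSSf1, hDNf1, hDPf1, hTN, hTP]
    exact h
  -- (5) assemble
  have hLf1 := hE1 s hs hne
  rw [cTN, cTP] at hLf1
  have hGfun : G = fun u => f1 u - Q u := funext hG
  -- the target, with `G` unfolded only at the outer occurrences
  have goal' : (s.len : ℝ) * (f1 s - Q s) -
      (((∑ o : InvIdx s, f1 (s.negSplitAt o)) - ∑ o : InvIdx s, Q (s.negSplitAt o))
        - ((∑ o : SameIdx s, f1 (s.posSplitAt o)) - ∑ o : SameIdx s, Q (s.posSplitAt o))
        + β * ((∑ o : DeformIdx s, f1 (s.negDeformAt o)) - ∑ o : DeformIdx s, Q (s.negDeformAt o))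
        - β * ((∑ o : DeformIdx s, f1 (s.posDeformAt o)) - ∑ o : DeformIdx s, Q (s.posDeformAt o))) =
      -∑ i : Fin s.length, PP i * (SIG i - SSG i) := by
    rw [cS, cI, cDN, cDP]
    have eF : (s.len : ℝ) * f0 s = ∑ i : Fin s.length, ((s.get i).length : ℝ) * (PP i * f0 [s.get i]) := by
      rw [eLen, Finset.sum_mul]; exact Finset.sum_congr rfl fun i _ => by rw [← ef0s i]
    have eQ : (s.len : ℝ) * Q s = ∑ i : Fin s.length, ((s.get i).length : ℝ) * (A i * f0 [s.get i] + PP i * f1 [s.get i]) := by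
      rw [eLen, Finset.sum_mul]; exact Finset.sum_congr rfl fun i _ => by rw [← eQs i]
    have key : ∀ i : Fin s.length,
        ((s.get i).length : ℝ) * (PP i * f0 [s.get i]) + (PP i * TN i - PP i * TP i)
          - ((s.get i).length : ℝ) * (A i * f0 [s.get i] + PP i * f1 [s.get i])
          + ((A i * SIf0 i + PP i * (SIf1 i - SIG i)) - (A i * SSf0 i + PP i * (SSf1 i - SSG i))
            + β * (A i * DNf0 i + PP i * DNf1 i) - β * (A i * DPf0 i + PP i * DPf1 i))
        = -(PP i * (SIG i - SSG i)) := by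
      intro i
      linear_combination (-(A i)) * E0 i - (PP i) * E1 i
    have hsum : ∑ i : Fin s.length, (((s.get i).length : ℝ) * (PP i * f0 [s.get i]) + (PP i * TN i - PP i * TP i)
          - ((s.get i).length : ℝ) * (A i * f0 [s.get i] + PP i * f1 [s.get i])
          + ((A i * SIf0 i + PP i * (SIf1 i - SIG i)) - (A i * SSf0 i + PP i * (SSf1 i - SSG i))
            + β * (A i * DNf0 i + PP i * DNf1 i) - β * (A i * DPf0 i + PP i * DPf1 i))) =
        ∑ i : Fin s.length, -(PP i * (SIG i - SSG i)) := Finset.sum_congr rfl fun i _ => key i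
    clear_value PP A SSf0 SSf1 SSG SIf0 SIf1 SIG DPf0 DPf1 DNf0 DNf1 TN TP
    have eF1 : (s.len : ℝ) * f1 s = ((s.len : ℝ) * f0 s + ((∑ i : Fin s.length, PP i * TN i) - ∑ i : Fin s.length, PP i * TP i))
        + ((∑ o : InvIdx s, f1 (s.negSplitAt o)) - (∑ o : SameIdx s, f1 (s.posSplitAt o))
          + β * (∑ o : DeformIdx s, f1 (s.negDeformAt o)) - β * (∑ o : DeformIdx s, f1 (s.posDeformAt o))) := by
      rw [← hLf1]; ring
    rw [mul_sub, eQ, eF1, eF]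
    simp only [Finset.sum_add_distrib, Finset.sum_sub_distrib, Finset.sum_neg_distrib, Finset.mul_sum, mul_add, mul_sub]
      at hsum ⊢
    linarith [hsum]
  conv_lhs => rw [hGfun]; simp only [Finset.sum_sub_distrib]
  exact goal'

end StringDuality

end Summit.QuantumFields.GaugeBoot

end
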